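import Summits.HodgeConjecture.HodgeConjecture.Theorems.F0P3cStCharTSUpTrSlotIntegrableH  -- ★-to-be FILE 2 (this seat): E's `hIntG`∕`hIntT` shapes for a generic guarded weight
import Summits.HodgeConjecture.HodgeConjecture.Theorems.F0P3cStCharTSUpTrSupportCompact   -- ★ (A0-iv) p852515 (F0P3b-p01 g20): `exists_isCompact_forall_conj_mem_centralizer`
import Summits.HodgeConjecture.HodgeConjecture.Theorems.F0P3cStCharTSUpMeas               -- ★ UP-MEAS (F0P3-p02): `measurable_of_locally_measurable`; brings ★ `finTau_eventually_eq`, ★ `finKappaAt_eventually_eq`, ★ CharField pins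
import Summits.HodgeConjecture.HodgeConjecture.Theorems.F0P3cStCharTSUpDom                -- ★ UP-DOM (LH4-p01): `norm_finTau_le_one`, `norm_finKappaAt_le_one`
import HarnessLib

/-!
# F0 · P3c · ROAD «UP-TR» brick (A1′)-(F4) «hIntG ∕ hIntT OF (A0 v2)»: the assembly's CONCRETE slot weight `K′ = 𝟙_reg·D_G⁻¹·(τ·D_H·κ·α)` along an admissible embedding is
# measurable, guarded and `D_G⁻¹`-dominated — hence E's two integrability binders, per slot, from the LB antecedent alone (Rogawski 1990 §12.5 pp. 182–183, §4.9 p. 55)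

Cell `pub/hodgecm-mathlib`, crux H413 = `stmt-HodgeConjecture-24833` (lane `--supports … --as helper`); seat F0P2-p01 (g24); ROAD «UP-TR» (holder F0P3-p02 (g23)); (A1′) F-carve item (F4)
(pen LH10-p01 (g8) 19:44:06Z; taken 19:46:55Z).  THEOREMS ONLY; sorry-free; no definition ∕ instance ∕ notation ∕ named fact; ★-only imports; axioms TRIO.

WHAT.  ★ (A1′)-E `upTransferLB_concrete_of_inputs` (tree `Theorems/F0P3cStCharTSUpTrAssemblyCore.lean` :135–:175) reads, per `H`-Cartan `T` and slot `i`, the weight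
`K′ s := (if IsRegularElt (eT T i s) then ((dG (eT T i s):ℂ))⁻¹ else 0) * (finTau s.1 μ * (dH s.1:ℂ) * (finKappaAt s.1 (eT T i s):ℂ) * α s.1)` on `↥T` and asks `hIntG` (the `↥T`-indexed orbit sum
of `K′` times `f` is integrable on `G`) and `hIntT` (`√radicand(eT s) • (K′ s · Φ_G([eT s], f))` integrable on `T^{G-reg}`).  ★ FILE 2 `…UpTrSlotIntegrableH` gives both for ANY measurable
guarded weight with `‖K′ s‖ ≤ B·D_G(e s)⁻¹`.  This file discharges those three hypotheses for THE weight above, ONE SLOT `(T_H, e : ↥T_H ≃ₜ* ↥Z_G(γ))` at a time (`dG`, `dH` abstract as in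
E; `hdGeq : dG = √√radicand` is (F1)'s instantiation, `rfl` there):
* §1 `slotWeight_eq_zero_of_not_isRegularElt` (the guard) · `measurable_slotWeight` — `τ(s)·κ(s, e s)` is LOCALLY CONSTANT on the open `G`-regular part of `T_H` (★ `finTau_eventually_eq`,
  ★ `finKappaAt_eventually_eq` at ★ `isUnit_eval_finCharpolyTwo_of_isLocalGRegular`, along the continuous `s ↦ (s, e s)` which is pointwise a norm pair), glued by ★ UP-MEAS
  `measurable_of_locally_measurable`; the remaining factors `𝟙_reg·dG(e s)⁻¹`, `dH`, `α` are measurable · `exists_bound_slotWeight` — `‖K′ s‖ ≤ B·dG(e s)⁻¹` whenever `e s` is regular with a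
  conjugate in `tsupport f`: `‖τ‖, ‖κ‖ ≤ 1` (★ UP-DOM §1, `μ` unitary) and `‖dH·α‖ ≤ B` on the compact `(e⁻¹ K)` ⊆ `H_v`, `K ⊆ Z_G(γ)` the ★ (A0-iv) compact catching every torus point with a
  conjugate in `tsupport f` — the LB antecedent `hLB` read once.
* §2 **`integrable_mul_orbitSum_slotWeight`** = E's `hIntG (T) (i)` and **`integrableOn_weighted_slotWeight_mul_classOrbitalIntegral`** = E's `hIntT (T) (i)` (★ FILE 2 at this weight), from:
  `hns`, `hμ : μ.IsUnitary`, `hdGeq`, `hdHm : Measurable dH`, `hα : Measurable α`, `hLB`, `hf : f ∈ SchwartzBruhat G`, `he` (pointwise norm pairs), and for the torus side `hcanQ`, `tH`, `htH`.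
HONEST LABEL: count-neutral; UP-TR block consequents move only at the rider editions; organs 2 = 2; h413 registry untouched; HC_CM is proved only modulo the printed citations
until rung 0 closes.

## References
* [Rogawski1990] J. D. Rogawski, *Automorphic Representations of Unitary Groups in Three Variables*, Ann. of Math. Stud. 123 (1990), §12.5 pp. 182–183 (L. 12.5.1), §4.9 p. 55
  (`τ`, `κ`, `D_{G∕H}`), §4.3 p. 43.
* [HarishChandra1970] Harish-Chandra (notes by G. van Dijk), *Harmonic analysis on reductive p-adic groups*, LNM 162 (1970), Part VII §1 Lemma 42 and Thm. 15.
* [LanglandsShelstad1987] R. P. Langlands, D. Shelstad, *On the definition of transfer factors*, Math. Ann. 278 (1987), §1.3, Lemma 4.1.A (local constancy of transfer factors).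
-/

set_option autoImplicit false
-- the mandated namespace has the single-problem summit's repeated segment (`HodgeConjecture.HodgeConjecture`)
set_option linter.dupNamespace false

noncomputable section

open MeasureTheory Measure Set Filter Topology Function NumberField IsDedekindDomain Matrix
open Literature.MeasureTheory.Group
open Literature.NumberTheory.Automorphic Literature.NumberTheory.Automorphic.UnitaryGroup Literature.NumberTheory.Rogawski1990
open Literature.NumberTheory.GaloisRepresentations
open Summit.HodgeConjecture.HodgeConjecture.Cruxes.H413
open Summit.HodgeConjecture.HodgeConjecture.Cruxes.H413.F0P3cStCharTSUpTrSlotIntegrable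
open Summit.HodgeConjecture.HodgeConjecture.Cruxes.H413.F0P3cStCharTSUpTrSlotIntegrableH
open Summit.HodgeConjecture.HodgeConjecture.Cruxes.H413.F0P3cStCharTSUpTrExchange
open Summit.HodgeConjecture.HodgeConjecture.Cruxes.H413.F0P3cStCharTSUpTrSupportCompact
open Summit.HodgeConjecture.HodgeConjecture.Cruxes.H413.F0P3cStCharTSUpMeas
open Summit.HodgeConjecture.HodgeConjecture.Cruxes.H413.F0P3cStCharTSUpDom
open scoped ENNReal NNReal MatrixGroups Pointwise Classical

namespace Summit.HodgeConjecture.HodgeConjecture.Cruxes.H413.F0P3cStCharTSUpTrSlotWeight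

variable (L : Type) [Field L] [NumberField L] [IsCMField L] (v : HeightOneSpectrum (𝓞 ↥(maximalRealSubfield L)))

/-! ## §1 The slot weight: guard, measurability, `D_G⁻¹`-domination -/

/-- **The guard**: the slot weight vanishes where `e s` is not regular (`if_neg`). [cite: Rogawski1990, §12.5 p. 183] -/
theorem slotWeight_eq_zero_of_not_isRegularElt {TH : Subgroup ((UnitaryGroup.cmDatum L 2 (Matrix.of fun i j : Fin 2 => if i.val + j.val + 1 = 2 then (1 : L) else 0)).Local v × (UnitaryGroup.cmDatum L 1 (Matrix.of fun i j : Fin 1 => if i.val + j.val + 1 = 1 then (1 : L) else 0)).Local v)} {γ : Gqs L v} (e : ↥TH ≃ₜ* ↥(Subgroup.centralizer ({γ} : Set (Gqs L v))))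
    (μ : HeckeCharacter L) (dG : Gqs L v → ℝ) (dH : ((UnitaryGroup.cmDatum L 2 (Matrix.of fun i j : Fin 2 => if i.val + j.val + 1 = 2 then (1 : L) else 0)).Local v × (UnitaryGroup.cmDatum L 1 (Matrix.of fun i j : Fin 1 => if i.val + j.val + 1 = 1 then (1 : L) else 0)).Local v) → ℝ) (α : ((UnitaryGroup.cmDatum L 2 (Matrix.of fun i j : Fin 2 => if i.val + j.val + 1 = 2 then (1 : L) else 0)).Local v × (UnitaryGroup.cmDatum L 1 (Matrix.of fun i j : Fin 1 => if i.val + j.val + 1 = 1 then (1 : L) else 0)).Local v) → ℂ) (s : ↥TH)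
    (hs : ¬ IsRegularElt ((((e s : ↥(Subgroup.centralizer ({γ} : Set (Gqs L v)))) : Gqs L v)).val : GL (Fin 3) (UnitaryGroup.LocalRing L v))) :
    (fun s : ↥TH => (if IsRegularElt ((((e s : ↥(Subgroup.centralizer ({γ} : Set (Gqs L v)))) : Gqs L v)).val : GL (Fin 3) (UnitaryGroup.LocalRing L v)) then ((dG ((e s : ↥(Subgroup.centralizer ({γ} : Set (Gqs L v)))) : Gqs L v) : ℂ))⁻¹ else 0) * (finTau L v s.1 μ * (dH s.1 : ℂ) * ((finKappaAt L v (qsForm L) s.1 ((e s : ↥(Subgroup.centralizer ({γ} : Set (Gqs L v)))) : Gqs L v) : ℤ) : ℂ) * α s.1)) s = 0 := by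
  simp only [if_neg hs, zero_mul]

set_option maxHeartbeats 1600000 in
set_option synthInstance.maxHeartbeats 400000 in
-- instance-term unification on the CM local carriers (as ★ UP-MEAS ∕ ★ (A1′)-E)
/-- **The slot weight is measurable on `T_H`.**  The transfer-factor scalars `τ(s)·κ(s, e s)` are LOCALLY CONSTANT on the open `G`-regular part of `T_H` (★ `finTau_eventually_eq`, ★
`finKappaAt_eventually_eq` — both at ★ `isUnit_eval_finCharpolyTwo_of_isLocalGRegular` — pulled back along the continuous `s ↦ (s, e s)`, pointwise a norm pair by `he`), so their
guarded product is measurable by ★ UP-MEAS `measurable_of_locally_measurable`; `𝟙_reg·dG(e s)⁻¹` (`dG = √√radicand` continuous), `dH`, `α` are measurable.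
[cite: Rogawski1990, §4.9 p. 55; §12.5 p. 183] [cite: LanglandsShelstad1987, Lemma 4.1.A] -/
theorem measurable_slotWeight
    (hns : ∀ w : PlacesOver L v, IsCMField.complexConj L • w.1 = w.1)
    [MeasurableSpace (Gqs L v)] [BorelSpace (Gqs L v)]
    [MeasurableSpace ((UnitaryGroup.cmDatum L 2 (Matrix.of fun i j : Fin 2 => if i.val + j.val + 1 = 2 then (1 : L) else 0)).Local v × (UnitaryGroup.cmDatum L 1 (Matrix.of fun i j : Fin 1 => if i.val + j.val + 1 = 1 then (1 : L) else 0)).Local v)] [BorelSpace ((UnitaryGroup.cmDatum L 2 (Matrix.of fun i j : Fin 2 => if i.val + j.val + 1 = 2 then (1 : L) else 0)).Local v × (UnitaryGroup.cmDatum L 1 (Matrix.of fun i j : Fin 1 => if i.val + j.val + 1 = 1 then (1 : L) else 0)).Local v)] [SecondCountableTopology ((UnitaryGroup.cmDatum L 2 (Matrix.of fun i j : Fin 2 => if i.val + j.val + 1 = 2 then (1 : L) else 0)).Local v × (UnitaryGroup.cmDatum L 1 (Matrix.of fun i j : Fin 1 => if i.val + j.val + 1 = 1 then (1 : L) else 0)).Local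 v)]
    {TH : Subgroup ((UnitaryGroup.cmDatum L 2 (Matrix.of fun i j : Fin 2 => if i.val + j.val + 1 = 2 then (1 : L) else 0)).Local v × (UnitaryGroup.cmDatum L 1 (Matrix.of fun i j : Fin 1 => if i.val + j.val + 1 = 1 then (1 : L) else 0)).Local v)} {γ : Gqs L v} (e : ↥TH ≃ₜ* ↥(Subgroup.centralizer ({γ} : Set (Gqs L v)))) (he : ∀ s : ↥TH, IsLocalNormPair L (qsForm L) v s.1 (e s).1)
    (μ : HeckeCharacter L) (dG : Gqs L v → ℝ) (hdGeq : ∀ g : Gqs L v, dG g = (((NNReal.sqrt (NNReal.sqrt ((∏ w : PlacesOver L v, IsNonarchimedeanLocalField.normAbs (w.1.adicCompletion L) (((g.val : GL (Fin 3) (UnitaryGroup.LocalRing L v)).val.charpoly.discr) w)) * ((∏ w : PlacesOver L v, IsNonarchimedeanLocalField.normAbs (w.1.adicCompletion L) (((g.val : GL (Fin 3) (UnitaryGroup.LocalRing L v)).val.det) w)) ^ 2)⁻¹))) : ℝ≥0) : ℝ))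
    (dH : ((UnitaryGroup.cmDatum L 2 (Matrix.of fun i j : Fin 2 => if i.val + j.val + 1 = 2 then (1 : L) else 0)).Local v × (UnitaryGroup.cmDatum L 1 (Matrix.of fun i j : Fin 1 => if i.val + j.val + 1 = 1 then (1 : L) else 0)).Local v) → ℝ) (hdHm : Measurable dH) (α : ((UnitaryGroup.cmDatum L 2 (Matrix.of fun i j : Fin 2 => if i.val + j.val + 1 = 2 then (1 : L) else 0)).Local v × (UnitaryGroup.cmDatum L 1 (Matrix.of fun i j : Fin 1 => if i.val + j.val + 1 = 1 then (1 : L) else 0)).Local v) → ℂ) (hα : Measurable α) :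
    Measurable (fun s : ↥TH => (if IsRegularElt ((((e s : ↥(Subgroup.centralizer ({γ} : Set (Gqs L v)))) : Gqs L v)).val : GL (Fin 3) (UnitaryGroup.LocalRing L v)) then ((dG ((e s : ↥(Subgroup.centralizer ({γ} : Set (Gqs L v)))) : Gqs L v) : ℂ))⁻¹ else 0) * (finTau L v s.1 μ * (dH s.1 : ℂ) * ((finKappaAt L v (qsForm L) s.1 ((e s : ↥(Subgroup.centralizer ({γ} : Set (Gqs L v)))) : Gqs L v) : ℤ) : ℂ) * α s.1)) := by
  classical
  obtain ⟨w₀⟩ := (inferInstance : Nonempty (PlacesOver L v))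
  -- the regular part of `T_H` along `e`, an open set
  have hce : Continuous fun s : ↥TH => ((e s : ↥(Subgroup.centralizer ({γ} : Set (Gqs L v)))) : Gqs L v) := continuous_subtype_val.comp e.continuous
  set U : Set ↥TH := {s : ↥TH | IsRegularElt ((((e s : ↥(Subgroup.centralizer ({γ} : Set (Gqs L v)))) : Gqs L v)).val : GL (Fin 3) (UnitaryGroup.LocalRing L v))} with hU
  have hUo : IsOpen U := (isOpen_setOf_isRegularElt_cmDatum_local (L := L) (H := qsForm L) (v := v) w₀ (hns w₀)).preimage hce
  -- the locally constant scalar `τ(s)·κ(s, e s)`, guarded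
  set τκ : ↥TH → ℂ := fun s => if IsRegularElt ((((e s : ↥(Subgroup.centralizer ({γ} : Set (Gqs L v)))) : Gqs L v)).val : GL (Fin 3) (UnitaryGroup.LocalRing L v)) then
      finTau L v s.1 μ * ((finKappaAt L v (qsForm L) s.1 ((e s : ↥(Subgroup.centralizer ({γ} : Set (Gqs L v)))) : Gqs L v) : ℤ) : ℂ) else 0 with hτκ
  have hτκm : Measurable τκ := by
    refine measurable_of_locally_measurable (U := U) τκ 0 (fun s₀ hs₀ => ?_) (fun s hs => by simp only [hτκ]; exact if_neg hs)
    have hreg₀ : IsLocalGRegular L v s₀.1 := (isLocalGRegular_iff_isRegularElt_of_isLocalNormPair L v (he s₀)).2 hs₀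
    have hu₀ := isUnit_eval_finCharpolyTwo_of_isLocalGRegular L v s₀.1 hreg₀
    have hτ : ∀ᶠ s in 𝓝 s₀, finTau L v s.1 μ = finTau L v s₀.1 μ :=
      (continuous_subtype_val.tendsto s₀).eventually (finTau_eventually_eq L v μ hu₀)
    have hpair : Tendsto (fun s : ↥TH => (s.1, ((e s : ↥(Subgroup.centralizer ({γ} : Set (Gqs L v)))) : Gqs L v))) (𝓝 s₀) (𝓝 (s₀.1, ((e s₀ : ↥(Subgroup.centralizer ({γ} : Set (Gqs L v)))) : Gqs L v))) :=
      ((continuous_subtype_val.prodMk hce).tendsto s₀)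
    have hκ : ∀ᶠ s in 𝓝 s₀, IsLocalNormPair L (qsForm L) v s.1 ((e s : ↥(Subgroup.centralizer ({γ} : Set (Gqs L v)))) : Gqs L v) →
        finKappaAt L v (qsForm L) s.1 ((e s : ↥(Subgroup.centralizer ({γ} : Set (Gqs L v)))) : Gqs L v) = finKappaAt L v (qsForm L) s₀.1 ((e s₀ : ↥(Subgroup.centralizer ({γ} : Set (Gqs L v)))) : Gqs L v) :=
      hpair.eventually (finKappaAt_eventually_eq L v (qsForm L) (F0P3cStCharTSCharField.qsForm_map_cmConjRingHom_transpose L)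
        (F0P3cStCharTSCharField.det_qsForm_ne_zero L) (he s₀) hu₀)
    have hUev : ∀ᶠ s in 𝓝 s₀, s ∈ U := hUo.mem_nhds hs₀
    obtain ⟨V, hV, hVo, hs₀V⟩ := eventually_nhds_iff.1 (hτ.and (hκ.and hUev))
    refine ⟨V, hVo, hs₀V, fun _ => τκ s₀, measurable_const, fun s hs => ?_⟩
    obtain ⟨h1, h2, h3⟩ := hV s hs
    have h3' : IsRegularElt ((((e s : ↥(Subgroup.centralizer ({γ} : Set (Gqs L v)))) : Gqs L v)).val : GL (Fin 3) (UnitaryGroup.LocalRing L v)) := h3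
    have h0' : IsRegularElt ((((e s₀ : ↥(Subgroup.centralizer ({γ} : Set (Gqs L v)))) : Gqs L v)).val : GL (Fin 3) (UnitaryGroup.LocalRing L v)) := hs₀
    simp only [hτκ]
    rw [if_pos h3', if_pos h0', h1, h2 (he s)]
  -- the guarded `dG⁻¹` factor and the remaining measurable factors
  have hdGc : Continuous dG := by
    have : dG = fun g : Gqs L v => (((NNReal.sqrt (NNReal.sqrt ((∏ w : PlacesOver L v, IsNonarchimedeanLocalField.normAbs (w.1.adicCompletion L) (((g.val : GL (Fin 3) (UnitaryGroup.LocalRing L v)).val.charpoly.discr) w)) * ((∏ w : PlacesOver L v, IsNonarchimedeanLocalField.normAbs (w.1.adicCompletion L) (((g.val : GL (Fin 3) (UnitaryGroup.LocalRing L v)).val.det) w)) ^ 2)⁻¹))) : ℝ≥0) : ℝ) := funext hdGeq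
    rw [this]; exact F0P3cStCharTSDGField.continuous_dgFormula L v
  have hGd : Measurable fun s : ↥TH => (if IsRegularElt ((((e s : ↥(Subgroup.centralizer ({γ} : Set (Gqs L v)))) : Gqs L v)).val : GL (Fin 3) (UnitaryGroup.LocalRing L v)) then ((dG ((e s : ↥(Subgroup.centralizer ({γ} : Set (Gqs L v)))) : Gqs L v) : ℂ))⁻¹ else 0) :=
    Measurable.ite hUo.measurableSet ((Complex.measurable_ofReal.comp (hdGc.measurable.comp hce.measurable)).inv) measurable_const
  have hrest : Measurable fun s : ↥TH => (dH s.1 : ℂ) * α s.1 :=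
    (Complex.measurable_ofReal.comp (hdHm.comp measurable_subtype_coe)).mul (hα.comp measurable_subtype_coe)
  -- the weight is `Gd · τκ · (dH·α)` pointwise
  have hEq : (fun s : ↥TH => (if IsRegularElt ((((e s : ↥(Subgroup.centralizer ({γ} : Set (Gqs L v)))) : Gqs L v)).val : GL (Fin 3) (UnitaryGroup.LocalRing L v)) then ((dG ((e s : ↥(Subgroup.centralizer ({γ} : Set (Gqs L v)))) : Gqs L v) : ℂ))⁻¹ else 0) * (finTau L v s.1 μ * (dH s.1 : ℂ) * ((finKappaAt L v (qsForm L) s.1 ((e s : ↥(Subgroup.centralizer ({γ} : Set (Gqs L v)))) : Gqs L v) : ℤ) : ℂ) * α s.1)) = fun s => (if IsRegularElt ((((e s : ↥(Subgroup.centralizer ({γ} : Set (Gqs L v)))) : Gqs L v)).val : GL (Fin 3) (UnitaryGroup.LocalRing L v)) then ((dG ((e s : ↥(Subgroup.centralizer ({γ} : Set (Gqs L v)))) : Gqs L v) : ℂ))⁻¹ else 0) * τκ s * ((dH s.1 : ℂ) * α s.1) := by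
    funext s
    by_cases hs : IsRegularElt ((((e s : ↥(Subgroup.centralizer ({γ} : Set (Gqs L v)))) : Gqs L v)).val : GL (Fin 3) (UnitaryGroup.LocalRing L v))
    · simp only [hτκ, if_pos hs]; ring
    · simp only [if_neg hs, zero_mul]
  rw [hEq]
  exact (hGd.mul hτκm).mul hrest

set_option maxHeartbeats 1600000 in
set_option synthInstance.maxHeartbeats 400000 in
-- instance-term unification on the CM local carriers (as ★ UP-DOM ∕ ★ (A0-iv))
/-- **`D_G⁻¹`-DOMINATION of the slot weight from the LB antecedent, read ONCE.**  With `μ` unitary (`‖τ‖ ≤ 1`, ★ UP-DOM), `‖κ‖ ≤ 1`, and `hLB : ‖dH·α‖` bounded on compacts of the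
`G`-regular set: there is `B` with `‖K′ s‖ ≤ B · dG(e s)⁻¹` for every `s` such that `e s` is regular and has a conjugate in `tsupport f` — all such `s` lie in the compact `e⁻¹(K)`,
`K ⊆ Z_G(γ)` the ★ (A0-iv) compact `exists_isCompact_forall_conj_mem_centralizer` for `C := tsupport f`. [cite: Rogawski1990, §4.9 p. 55; §12.5 p. 183] [cite: HarishChandra1970, Part VII §1 Lemma 42 and Thm. 15] -/
theorem exists_bound_slotWeight
    (hns : ∀ w : PlacesOver L v, IsCMField.complexConj L • w.1 = w.1)
    {TH : Subgroup ((UnitaryGroup.cmDatum L 2 (Matrix.of fun i j : Fin 2 => if i.val + j.val + 1 = 2 then (1 : L) else 0)).Local v × (UnitaryGroup.cmDatum L 1 (Matrix.of fun i j : Fin 1 => if i.val + j.val + 1 = 1 then (1 : L) else 0)).Local v)} {γ : Gqs L v} (hγ : IsRegularElt (γ.val : GL (Fin 3) (UnitaryGroup.LocalRing L v)))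
    (e : ↥TH ≃ₜ* ↥(Subgroup.centralizer ({γ} : Set (Gqs L v)))) (he : ∀ s : ↥TH, IsLocalNormPair L (qsForm L) v s.1 (e s).1)
    (μ : HeckeCharacter L) (hμ : μ.IsUnitary) (dG : Gqs L v → ℝ) (hdGeq : ∀ g : Gqs L v, dG g = (((NNReal.sqrt (NNReal.sqrt ((∏ w : PlacesOver L v, IsNonarchimedeanLocalField.normAbs (w.1.adicCompletion L) (((g.val : GL (Fin 3) (UnitaryGroup.LocalRing L v)).val.charpoly.discr) w)) * ((∏ w : PlacesOver L v, IsNonarchimedeanLocalField.normAbs (w.1.adicCompletion L) (((g.val : GL (Fin 3) (UnitaryGroup.LocalRing L v)).val.det) w)) ^ 2)⁻¹))) : ℝ≥0) : ℝ))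
    (dH : ((UnitaryGroup.cmDatum L 2 (Matrix.of fun i j : Fin 2 => if i.val + j.val + 1 = 2 then (1 : L) else 0)).Local v × (UnitaryGroup.cmDatum L 1 (Matrix.of fun i j : Fin 1 => if i.val + j.val + 1 = 1 then (1 : L) else 0)).Local v) → ℝ) (α : ((UnitaryGroup.cmDatum L 2 (Matrix.of fun i j : Fin 2 => if i.val + j.val + 1 = 2 then (1 : L) else 0)).Local v × (UnitaryGroup.cmDatum L 1 (Matrix.of fun i j : Fin 1 => if i.val + j.val + 1 = 1 then (1 : L) else 0)).Local v) → ℂ)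
    (hLB : ∀ C : Set ((UnitaryGroup.cmDatum L 2 (Matrix.of fun i j : Fin 2 => if i.val + j.val + 1 = 2 then (1 : L) else 0)).Local v × (UnitaryGroup.cmDatum L 1 (Matrix.of fun i j : Fin 1 => if i.val + j.val + 1 = 1 then (1 : L) else 0)).Local v), IsCompact C → ∃ B : ℝ, ∀ s ∈ C, IsLocalGRegular L v s → ‖(dH s : ℂ) * α s‖ ≤ B)
    (f : Gqs L v → ℂ) (hf : f ∈ SchwartzBruhat (Gqs L v)) :
    ∃ B : ℝ, ∀ s : ↥TH, IsRegularElt ((((e s : ↥(Subgroup.centralizer ({γ} : Set (Gqs L v)))) : Gqs L v)).val : GL (Fin 3) (UnitaryGroup.LocalRing L v)) → (∃ x : Gqs L v, x * ((e s : ↥(Subgroup.centralizer ({γ} : Set (Gqs L v)))) : Gqs L v) * x⁻¹ ∈ tsupport f) →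
      ‖(fun s : ↥TH => (if IsRegularElt ((((e s : ↥(Subgroup.centralizer ({γ} : Set (Gqs L v)))) : Gqs L v)).val : GL (Fin 3) (UnitaryGroup.LocalRing L v)) then ((dG ((e s : ↥(Subgroup.centralizer ({γ} : Set (Gqs L v)))) : Gqs L v) : ℂ))⁻¹ else 0) * (finTau L v s.1 μ * (dH s.1 : ℂ) * ((finKappaAt L v (qsForm L) s.1 ((e s : ↥(Subgroup.centralizer ({γ} : Set (Gqs L v)))) : Gqs L v) : ℤ) : ℂ) * α s.1)) s‖ ≤ B * ((((NNReal.sqrt (NNReal.sqrt ((∏ w : PlacesOver L v, IsNonarchimedeanLocalField.normAbs (w.1.adicCompletion L) ((((((e s : ↥(Subgroup.centralizer ({γ} : Set (Gqs L v)))) : Gqs L v)).val : GL (Fin 3) (UnitaryGroup.LocalRing L v)).val.charpoly.discr) w)) * ((∏ w : PlacesOver L v, IsNonarchimedeanLocalField.normAbs (w.1.adicCompletion L) ((((((e s : ↥(Subgroup.centralizer ({γ} : Set (Gqs L v)))) : Gqs L v)).val : GL (Fin 3) (UnitaryGroup.LocalRing L v)).val.det) w)) ^ 2)⁻¹))) :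 ℝ≥0) : ℝ))⁻¹ := by
  obtain ⟨K, hK, hKmem⟩ := exists_isCompact_forall_conj_mem_centralizer L v hns γ hγ (tsupport f) hf.2.isCompact
  set C : Set ((UnitaryGroup.cmDatum L 2 (Matrix.of fun i j : Fin 2 => if i.val + j.val + 1 = 2 then (1 : L) else 0)).Local v × (UnitaryGroup.cmDatum L 1 (Matrix.of fun i j : Fin 1 => if i.val + j.val + 1 = 1 then (1 : L) else 0)).Local v) := Subtype.val '' (e.symm '' K) with hC
  have hCc : IsCompact C := (hK.image e.symm.continuous).image continuous_subtype_val
  obtain ⟨B, hB⟩ := hLB C hCc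
  refine ⟨B, fun s hreg hmeet => ?_⟩
  have hsC : (s : ((UnitaryGroup.cmDatum L 2 (Matrix.of fun i j : Fin 2 => if i.val + j.val + 1 = 2 then (1 : L) else 0)).Local v × (UnitaryGroup.cmDatum L 1 (Matrix.of fun i j : Fin 1 => if i.val + j.val + 1 = 1 then (1 : L) else 0)).Local v)) ∈ C := ⟨e.symm (e s), ⟨e s, hKmem (e s) hmeet, rfl⟩, by rw [ContinuousMulEquiv.symm_apply_apply]⟩
  have hsreg : IsLocalGRegular L v s.1 := (isLocalGRegular_iff_isRegularElt_of_isLocalNormPair L v (he s)).2 hreg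
  have hBs := hB s.1 hsC hsreg
  have hdG0 : 0 ≤ dG ((e s : ↥(Subgroup.centralizer ({γ} : Set (Gqs L v)))) : Gqs L v) := by rw [hdGeq]; exact NNReal.coe_nonneg _
  have hinv : ‖((dG ((e s : ↥(Subgroup.centralizer ({γ} : Set (Gqs L v)))) : Gqs L v) : ℂ))⁻¹‖ = ((((NNReal.sqrt (NNReal.sqrt ((∏ w : PlacesOver L v, IsNonarchimedeanLocalField.normAbs (w.1.adicCompletion L) ((((((e s : ↥(Subgroup.centralizer ({γ} : Set (Gqs L v)))) : Gqs L v)).val : GL (Fin 3) (UnitaryGroup.LocalRing L v)).val.charpoly.discr) w)) * ((∏ w : PlacesOver L v, IsNonarchimedeanLocalField.normAbs (w.1.adicCompletion L) ((((((e s : ↥(Subgroup.centralizer ({γ} : Set (Gqs L v)))) : Gqs L v)).val : GL (Fin 3) (UnitaryGroup.LocalRing L v)).val.det) w)) ^ 2)⁻¹))) : ℝ≥0) : ℝ))⁻¹ := by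
    rw [norm_inv, Complex.norm_real, Real.norm_eq_abs, abs_of_nonneg hdG0, hdGeq]
  simp only [if_pos hreg]
  rw [norm_mul, hinv, mul_comm]
  refine mul_le_mul_of_nonneg_right ?_ (inv_nonneg.2 (NNReal.coe_nonneg _))
  -- `‖τ · dH · κ · α‖ ≤ ‖dH · α‖ ≤ B`
  have h1 := norm_finTau_le_one L v μ hμ s.1
  have h2 := norm_finKappaAt_le_one L v (qsForm L) s.1 ((e s : ↥(Subgroup.centralizer ({γ} : Set (Gqs L v)))) : Gqs L v)
  calc ‖finTau L v s.1 μ * (dH s.1 : ℂ) * ((finKappaAt L v (qsForm L) s.1 ((e s : ↥(Subgroup.centralizer ({γ} : Set (Gqs L v)))) : Gqs L v) : ℤ) : ℂ) * α s.1‖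
      = ‖finTau L v s.1 μ‖ * ‖((finKappaAt L v (qsForm L) s.1 ((e s : ↥(Subgroup.centralizer ({γ} : Set (Gqs L v)))) : Gqs L v) : ℤ) : ℂ)‖ * ‖(dH s.1 : ℂ) * α s.1‖ := by
        rw [norm_mul, norm_mul, norm_mul, norm_mul]; ring
    _ ≤ 1 * 1 * ‖(dH s.1 : ℂ) * α s.1‖ := by gcongr
    _ ≤ B := by rw [one_mul, one_mul]; exact hBs

/-! ## §2 E's binders `hIntG (T) (i)` and `hIntT (T) (i)` for the concrete slot weight -/

set_option maxHeartbeats 1600000 in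
set_option synthInstance.maxHeartbeats 400000 in
-- instance-term unification on the CM local carriers (as ★ (A1′)-E)
/-- **(F4)(G) = E's `hIntG T hT i` AT `TH := T`, `e := eT T i`, `γ := γc T i`.**  For `μ` unitary, `dG = √√radicand`, `dH` and `α` measurable with the LB antecedent `hLB`, `f ∈ SchwartzBruhat G`,
and a slot `e : T_H ≃ₜ* Z_G(γ)` pointwise a norm pair: **`y ↦ f(y) · Σ_{s ∈ T_H, e s ∼ y} K′ s` is integrable on `G`** (★ FILE 2 `integrable_mul_orbitSum_embedding_of_le` at §1's three facts).
[cite: Rogawski1990, §12.5 pp. 182–183] [cite: HarishChandra1970, Part VII §1 Lemma 42 and Thm. 15] -/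
theorem integrable_mul_orbitSum_slotWeight
    (hns : ∀ w : PlacesOver L v, IsCMField.complexConj L • w.1 = w.1)
    [MeasurableSpace (Gqs L v)] [BorelSpace (Gqs L v)] [LocallyCompactSpace (Gqs L v)] [SecondCountableTopology (Gqs L v)] [T2Space (Gqs L v)]
    [MeasurableSpace ((UnitaryGroup.cmDatum L 2 (Matrix.of fun i j : Fin 2 => if i.val + j.val + 1 = 2 then (1 : L) else 0)).Local v × (UnitaryGroup.cmDatum L 1 (Matrix.of fun i j : Fin 1 => if i.val + j.val + 1 = 1 then (1 : L) else 0)).Local v)] [BorelSpace ((UnitaryGroup.cmDatum L 2 (Matrix.of fun i j : Fin 2 => if i.val + j.val + 1 = 2 then (1 : L) else 0)).Local v × (UnitaryGroup.cmDatum L 1 (Matrix.of fun i j : Fin 1 => if i.val + j.val + 1 = 1 then (1 : L) else 0)).Local v)] [SecondCountableTopology ((UnitaryGroup.cmDatum L 2 (Matrix.of fun i j : Fin 2 => if i.val + j.val + 1 = 2 then (1 : L) else 0)).Local v × (UnitaryGroup.cmDatum L 1 (Matrix.of fun i j : Fin 1 => if i.val + j.val + 1 = 1 then (1 : L) else 0)).Local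 v)]
    (ν : Measure (Gqs L v)) [ν.IsHaarMeasure]
    {TH : Subgroup ((UnitaryGroup.cmDatum L 2 (Matrix.of fun i j : Fin 2 => if i.val + j.val + 1 = 2 then (1 : L) else 0)).Local v × (UnitaryGroup.cmDatum L 1 (Matrix.of fun i j : Fin 1 => if i.val + j.val + 1 = 1 then (1 : L) else 0)).Local v)} {γ : Gqs L v} (hγ : IsRegularElt (γ.val : GL (Fin 3) (UnitaryGroup.LocalRing L v)))
    (e : ↥TH ≃ₜ* ↥(Subgroup.centralizer ({γ} : Set (Gqs L v)))) (he : ∀ s : ↥TH, IsLocalNormPair L (qsForm L) v s.1 (e s).1)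
    (μ : HeckeCharacter L) (hμ : μ.IsUnitary) (dG : Gqs L v → ℝ) (hdGeq : ∀ g : Gqs L v, dG g = (((NNReal.sqrt (NNReal.sqrt ((∏ w : PlacesOver L v, IsNonarchimedeanLocalField.normAbs (w.1.adicCompletion L) (((g.val : GL (Fin 3) (UnitaryGroup.LocalRing L v)).val.charpoly.discr) w)) * ((∏ w : PlacesOver L v, IsNonarchimedeanLocalField.normAbs (w.1.adicCompletion L) (((g.val : GL (Fin 3) (UnitaryGroup.LocalRing L v)).val.det) w)) ^ 2)⁻¹))) : ℝ≥0) : ℝ))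
    (dH : ((UnitaryGroup.cmDatum L 2 (Matrix.of fun i j : Fin 2 => if i.val + j.val + 1 = 2 then (1 : L) else 0)).Local v × (UnitaryGroup.cmDatum L 1 (Matrix.of fun i j : Fin 1 => if i.val + j.val + 1 = 1 then (1 : L) else 0)).Local v) → ℝ) (hdHm : Measurable dH) (α : ((UnitaryGroup.cmDatum L 2 (Matrix.of fun i j : Fin 2 => if i.val + j.val + 1 = 2 then (1 : L) else 0)).Local v × (UnitaryGroup.cmDatum L 1 (Matrix.of fun i j : Fin 1 => if i.val + j.val + 1 = 1 then (1 : L) else 0)).Local v) → ℂ) (hα : Measurable α)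
    (hLB : ∀ C : Set ((UnitaryGroup.cmDatum L 2 (Matrix.of fun i j : Fin 2 => if i.val + j.val + 1 = 2 then (1 : L) else 0)).Local v × (UnitaryGroup.cmDatum L 1 (Matrix.of fun i j : Fin 1 => if i.val + j.val + 1 = 1 then (1 : L) else 0)).Local v), IsCompact C → ∃ B : ℝ, ∀ s ∈ C, IsLocalGRegular L v s → ‖(dH s : ℂ) * α s‖ ≤ B)
    (f : Gqs L v → ℂ) (hf : f ∈ SchwartzBruhat (Gqs L v)) :
    Integrable (fun y : Gqs L v => f y *
      ∑ᶠ s : ↥TH, {s' : ↥TH | IsConj (((e s' : ↥(Subgroup.centralizer ({γ} : Set (Gqs L v)))) : Gqs L v)) y}.indicator (fun s : ↥TH => (if IsRegularElt ((((e s : ↥(Subgroup.centralizer ({γ} : Set (Gqs L v)))) : Gqs L v)).val : GL (Fin 3) (UnitaryGroup.LocalRing L v)) then ((dG ((e s : ↥(Subgroup.centralizer ({γ} : Set (Gqs L v)))) : Gqs L v) : ℂ))⁻¹ else 0) * (finTau L v s.1 μ * (dH s.1 : ℂ) * ((finKappaAt L v (qsForm L) s.1 ((e s : ↥(Subgroup.centralizer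 ({γ} : Set (Gqs L v)))) : Gqs L v) : ℤ) : ℂ) * α s.1)) s) ν := by
  obtain ⟨B, hB⟩ := exists_bound_slotWeight L v hns hγ e he μ hμ dG hdGeq dH α hLB f hf
  exact integrable_mul_orbitSum_embedding_of_le L v hns ν hγ rfl e f hf _
    (measurable_slotWeight L v hns e he μ dG hdGeq dH hdHm α hα) (slotWeight_eq_zero_of_not_isRegularElt L v e μ dG dH α) B hB

set_option maxHeartbeats 1600000 in
set_option synthInstance.maxHeartbeats 400000 in
-- instance-term unification on the CM local carriers (as ★ (A1′)-E)
/-- **(F4)(T) = E's `hIntT T hT i` AT `TH := T`, `e := eT T i`, `γ := γc T i`.**  Same data plus `mQv` canonical and `tH` a Haar measure on `T_H` with mass one on `compactCore T_H`: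
**`s ↦ √radicand(e s) • (K′ s · classOrbitalIntegral mQv f ⟦e s⟧)` is `tH`-integrable on `T_H^{G-reg}`** (★ FILE 2 `integrableOn_weighted_mul_classOrbitalIntegral_embedding_of_le` at §1's facts).
[cite: Rogawski1990, §12.5 pp. 182–183; §4.3 (4.3.1) p. 43] [cite: HarishChandra1970, Part VII §1 Lemma 42 and Thm. 15] -/
theorem integrableOn_weighted_slotWeight_mul_classOrbitalIntegral
    (hns : ∀ w : PlacesOver L v, IsCMField.complexConj L • w.1 = w.1)
    [MeasurableSpace (Gqs L v)] [BorelSpace (Gqs L v)] [LocallyCompactSpace (Gqs L v)] [SecondCountableTopology (Gqs L v)] [T2Space (Gqs L v)]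
    [∀ γ' : Gqs L v, MeasurableSpace (Gqs L v ⧸ Subgroup.centralizer ({γ'} : Set (Gqs L v)))]
    [∀ γ' : Gqs L v, BorelSpace (Gqs L v ⧸ Subgroup.centralizer ({γ'} : Set (Gqs L v)))]
    [MeasurableSpace ((UnitaryGroup.cmDatum L 2 (Matrix.of fun i j : Fin 2 => if i.val + j.val + 1 = 2 then (1 : L) else 0)).Local v × (UnitaryGroup.cmDatum L 1 (Matrix.of fun i j : Fin 1 => if i.val + j.val + 1 = 1 then (1 : L) else 0)).Local v)] [BorelSpace ((UnitaryGroup.cmDatum L 2 (Matrix.of fun i j : Fin 2 => if i.val + j.val + 1 = 2 then (1 : L) else 0)).Local v × (UnitaryGroup.cmDatum L 1 (Matrix.of fun i j : Fin 1 => if i.val + j.val + 1 = 1 then (1 : L) else 0)).Local v)] [SecondCountableTopology ((UnitaryGroup.cmDatum L 2 (Matrix.of fun i j : Fin 2 => if i.val + j.val + 1 = 2 then (1 : L) else 0)).Local v × (UnitaryGroup.cmDatum L 1 (Matrix.of fun i j : Fin 1 => if i.val + j.val + 1 = 1 then (1 : L) else 0)).Local v)]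
    (ν : Measure (Gqs L v)) [ν.IsHaarMeasure] [ν.IsMulRightInvariant]
    {mQv : OrbitalMeasureFamily (Gqs L v)} (hcanQ : mQv.IsCanonical (fun γ' => IsRegularElt (γ'.val : GL (Fin 3) (UnitaryGroup.LocalRing L v))) ν)
    {TH : Subgroup ((UnitaryGroup.cmDatum L 2 (Matrix.of fun i j : Fin 2 => if i.val + j.val + 1 = 2 then (1 : L) else 0)).Local v × (UnitaryGroup.cmDatum L 1 (Matrix.of fun i j : Fin 1 => if i.val + j.val + 1 = 1 then (1 : L) else 0)).Local v)} (tH : Measure ↥TH) [tH.IsHaarMeasure] (htH : tH (compactCore ↥TH) = 1)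
    {γ : Gqs L v} (hγ : IsRegularElt (γ.val : GL (Fin 3) (UnitaryGroup.LocalRing L v)))
    (e : ↥TH ≃ₜ* ↥(Subgroup.centralizer ({γ} : Set (Gqs L v)))) (he : ∀ s : ↥TH, IsLocalNormPair L (qsForm L) v s.1 (e s).1)
    (μ : HeckeCharacter L) (hμ : μ.IsUnitary) (dG : Gqs L v → ℝ) (hdGeq : ∀ g : Gqs L v, dG g = (((NNReal.sqrt (NNReal.sqrt ((∏ w : PlacesOver L v, IsNonarchimedeanLocalField.normAbs (w.1.adicCompletion L) (((g.val : GL (Fin 3) (UnitaryGroup.LocalRing L v)).val.charpoly.discr) w)) * ((∏ w : PlacesOver L v, IsNonarchimedeanLocalField.normAbs (w.1.adicCompletion L) (((g.val : GL (Fin 3) (UnitaryGroup.LocalRing L v)).val.det) w)) ^ 2)⁻¹))) : ℝ≥0) : ℝ))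
    (dH : ((UnitaryGroup.cmDatum L 2 (Matrix.of fun i j : Fin 2 => if i.val + j.val + 1 = 2 then (1 : L) else 0)).Local v × (UnitaryGroup.cmDatum L 1 (Matrix.of fun i j : Fin 1 => if i.val + j.val + 1 = 1 then (1 : L) else 0)).Local v) → ℝ) (hdHm : Measurable dH) (α : ((UnitaryGroup.cmDatum L 2 (Matrix.of fun i j : Fin 2 => if i.val + j.val + 1 = 2 then (1 : L) else 0)).Local v × (UnitaryGroup.cmDatum L 1 (Matrix.of fun i j : Fin 1 => if i.val + j.val + 1 = 1 then (1 : L) else 0)).Local v) → ℂ) (hα : Measurable α)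
    (hLB : ∀ C : Set ((UnitaryGroup.cmDatum L 2 (Matrix.of fun i j : Fin 2 => if i.val + j.val + 1 = 2 then (1 : L) else 0)).Local v × (UnitaryGroup.cmDatum L 1 (Matrix.of fun i j : Fin 1 => if i.val + j.val + 1 = 1 then (1 : L) else 0)).Local v), IsCompact C → ∃ B : ℝ, ∀ s ∈ C, IsLocalGRegular L v s → ‖(dH s : ℂ) * α s‖ ≤ B)
    (f : Gqs L v → ℂ) (hf : f ∈ SchwartzBruhat (Gqs L v)) :
    IntegrableOn (fun s : ↥TH => ((NNReal.sqrt ((∏ w : PlacesOver L v, IsNonarchimedeanLocalField.normAbs (w.1.adicCompletion L) ((((((e s : ↥(Subgroup.centralizer ({γ} : Set (Gqs L v)))) : Gqs L v)).val : GL (Fin 3) (UnitaryGroup.LocalRing L v)).val.charpoly.discr) w)) * ((∏ w : PlacesOver L v, IsNonarchimedeanLocalField.normAbs (w.1.adicCompletion L) ((((((e s : ↥(Subgroup.centralizer ({γ} : Set (Gqs L v)))) : Gqs L v)).val : GL (Fin 3) (UnitaryGroup.LocalRing L v)).val.det) w)) ^ 2)⁻¹) : ℝ≥0) : ℝ) 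•
        ((fun s : ↥TH => (if IsRegularElt ((((e s : ↥(Subgroup.centralizer ({γ} : Set (Gqs L v)))) : Gqs L v)).val : GL (Fin 3) (UnitaryGroup.LocalRing L v)) then ((dG ((e s : ↥(Subgroup.centralizer ({γ} : Set (Gqs L v)))) : Gqs L v) : ℂ))⁻¹ else 0) * (finTau L v s.1 μ * (dH s.1 : ℂ) * ((finKappaAt L v (qsForm L) s.1 ((e s : ↥(Subgroup.centralizer ({γ} : Set (Gqs L v)))) : Gqs L v) : ℤ) : ℂ) * α s.1)) s * classOrbitalIntegral mQv f (ConjClasses.mk ((e s : ↥(Subgroup.centralizer ({γ} : Set (Gqs L v)))) : Gqs L v))))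
      {s : ↥TH | IsLocalGRegular L v (s : ((UnitaryGroup.cmDatum L 2 (Matrix.of fun i j : Fin 2 => if i.val + j.val + 1 = 2 then (1 : L) else 0)).Local v × (UnitaryGroup.cmDatum L 1 (Matrix.of fun i j : Fin 1 => if i.val + j.val + 1 = 1 then (1 : L) else 0)).Local v))} tH := by
  obtain ⟨B, hB⟩ := exists_bound_slotWeight L v hns hγ e he μ hμ dG hdGeq dH α hLB f hf
  exact integrableOn_weighted_mul_classOrbitalIntegral_embedding_of_le L v hns ν hcanQ tH htH hγ rfl e he f hf _
    (measurable_slotWeight L v hns e he μ dG hdGeq dH hdHm α hα) B hB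

end Summit.HodgeConjecture.HodgeConjecture.Cruxes.H413.F0P3cStCharTSUpTrSlotWeight

end
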